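import Mathlib
import HarnessLib
import Literature.MathematicalPhysics.StatisticalMechanics.TaylorPolynomialNorms
import Literature.MathematicalPhysics.QuantumFieldTheory.TphiSeminorm
import Literature.MathematicalPhysics.QuantumFieldTheory.TphiSeminormExpectation
import Literature.MathematicalPhysics.QuantumFieldTheory.TphiSeminormExp

/-!
# Norms on Taylor polynomials relative to a gauge — III. Bridge to the `T_φ(𝔥)`-seminorm library:
# Gaussian integration contracts the norm, exponentials (ABKM19 Lemma 8.4 / BBS Prop. 7.3.1, (7.1.4))

The gauge Taylor norm `tayNorm T r₀ F φ` of `TaylorPolynomialNorms.lean` ([ABKM19] Def. 13.7, tensor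
norm `ι = ∧`) is, BY CONSTRUCTION, the Bauerschmidt–Brydges–Slade `T_φ(𝔥)`-seminorm of the tree
(`Literature.MathematicalPhysics.QuantumFieldTheory.tphiSeminorm`, BBS Def. 7.1.1, `𝔥 = 1`) of the
LIFT `gaugeLift T F` at the point `T φ` of the gauge space `range T`:

`tayNorm T r₀ F φ = tphiSeminorm r₀ 1 (gaugeLift T F) (T φ)`  (`tayNorm_eq_tphiSeminorm`).

Through this identity the `T_φ` library (product property, exponentials, differentiation under the
integral sign, Taylor remainders) applies to the gradient-model norms `|·|_{k,X,T_φ}` of [ABKM19]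
Ch. 6.4.  This file transports the two facts the renormalisation map needs first:

* **`tayNorm_integral_comp_add_le`** — Gaussian (or any) integration CONTRACTS the norm:
  `‖∫ K(· + ξ) μ(dξ)‖_{T_φ} ≤ ∫ ‖K‖_{T_{φ+ξ}} μ(dξ)` for a `T`-local `K`, under local domination of
  the derivatives of the lift (`DerivDominated`, supplied in [ABKM19] by the large-field weights) —
  the core of [ABKM19] Lemma 8.4 (`‖R_{k+1} K‖ ≤ …`, "regularity of the integration map") =
  [BBS19] (7.3.3); the lift of the convolution is the convolution of the lift along `T`
  (`gaugeLift_integral_comp_add`, by locality);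
* **`tayNorm_cexp_le_exp`**, `tayNorm_exp_le_exp` — `‖e^{F}‖_{T_φ} ≤ e^{‖F‖_{T_φ}}` (complex and
  real; [BBS19] (7.1.4)), the estimate behind the exponential map `H ↦ e^{−H}` of [ABKM19] Lemma 8.6.

Everything is proved; no named fact.

## References
* S. Adams, S. Buchholz, R. Kotecký, S. Müller, arXiv:1910.13564, Lemma 8.4, Lemma 8.6
  [AdamsBuchholzKoteckyMuller2019].
* R. Bauerschmidt, D. Brydges, G. Slade, *Introduction to a renormalisation group method*,
  LNM 2242 (2019), Prop. 7.3.1, (7.1.4) [BauerschmidtBrydgesSlade2019RG].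
-/

noncomputable section

namespace Literature.MathematicalPhysics.StatisticalMechanics.GradientRG

open MeasureTheory Finset
open Literature.MathematicalPhysics.QuantumFieldTheory

variable {E V : Type*} [NormedAddCommGroup E] [NormedSpace ℝ E]
  [NormedAddCommGroup V] [NormedSpace ℝ V]
  {𝔸 : Type*} [NormedRing 𝔸] [NormedAlgebra ℝ 𝔸]

/-- **The gauge Taylor norm is the `T_φ(1)`-seminorm of the lift at `Tφ`.**
[cite: AdamsBuchholzKoteckyMuller2019, Definition 13.7] -/
theorem tayNorm_eq_tphiSeminorm (T : E →ₗ[ℝ] V) (r₀ : ℕ) (F : E → 𝔸) (φ : E) :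
    tayNorm T r₀ F φ = tphiSeminorm r₀ 1 (gaugeLift T F) (T.rangeRestrict φ) := by
  unfold tayNorm tphiSeminorm
  refine Finset.sum_congr rfl fun s _ => ?_
  rw [one_pow, one_div]

omit [NormedRing 𝔸] [NormedAlgebra ℝ 𝔸] in
/-- For a `T`-local `K`, translating the argument by `ξ` and lifting is translating the lift by
`T ξ`: `gaugeLift T (K(· + ξ)) w = gaugeLift T K (w + Tξ)`.
[cite: AdamsBuchholzKoteckyMuller2019, Ch. 6.4 (remark after (6.46))] -/
theorem gaugeLift_comp_add {T : E →ₗ[ℝ] V} {K : E → 𝔸} (hK : IsGaugeLocal T K) (ξ : E)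
    (w : LinearMap.range T) :
    gaugeLift T (fun ψ => K (ψ + ξ)) w = gaugeLift T K (w + T.rangeRestrict ξ) := by
  rw [gaugeLift_apply, gaugeLift_apply]
  apply hK
  simp only [map_add, apply_gaugeSection]
  rfl

/-- **The lift of a convolution is the convolution of the lift along `T`** (locality): for
`T`-local `K` and any measure `μ` on fields,
`gaugeLift T (φ ↦ ∫ K(φ + ξ) μ(dξ)) w = ∫ gaugeLift T K (w + Tξ) μ(dξ)`.
[cite: AdamsBuchholzKoteckyMuller2019, Lemma 8.4 (the map R_{k+1})] -/
theorem gaugeLift_integral_comp_add [MeasurableSpace E] {T : E →ₗ[ℝ] V} {K : E → 𝔸}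
    (hK : IsGaugeLocal T K) (μ : Measure E) (w : LinearMap.range T) :
    gaugeLift T (fun ψ => ∫ ξ, K (ψ + ξ) ∂μ) w = ∫ ξ, gaugeLift T K (w + T.rangeRestrict ξ) ∂μ := by
  simp only [gaugeLift_apply]
  refine integral_congr_ae (Filter.Eventually.of_forall fun ξ => ?_)
  exact gaugeLift_comp_add hK ξ w

/-- **Integration contracts the Taylor norm** ([ABKM19] Lemma 8.4 core; [BBS19] (7.3.3)): for a
`T`-local `K` with values in a complete normed algebra and any measure `μ` on fields, if the
derivatives of the lift are locally dominated (`DerivDominated r₀ (w ξ ↦ K̄(w + Tξ)) μ`), then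
`‖∫ K(· + ξ) μ(dξ)‖_{T_φ} ≤ ∫ ‖K‖_{T_{φ+ξ}} μ(dξ)`.
[cite: AdamsBuchholzKoteckyMuller2019, Lemma 8.4] -/
theorem tayNorm_integral_comp_add_le [MeasurableSpace E] [CompleteSpace 𝔸] {T : E →ₗ[ℝ] V} {r₀ : ℕ}
    {K : E → 𝔸} (hK : IsGaugeLocal T K) {μ : Measure E}
    (hdom : DerivDominated r₀
      (fun (w : LinearMap.range T) (ξ : E) => gaugeLift T K (w + T.rangeRestrict ξ)) μ) (φ : E) :
    tayNorm T r₀ (fun ψ => ∫ ξ, K (ψ + ξ) ∂μ) φ ≤ ∫ ξ, tayNorm T r₀ K (φ + ξ) ∂μ := by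
  rw [tayNorm_eq_tphiSeminorm]
  have hlift : gaugeLift T (fun ψ => ∫ ξ, K (ψ + ξ) ∂μ) =
      fun w => ∫ ξ, gaugeLift T K (w + T.rangeRestrict ξ) ∂μ := by
    funext w
    exact gaugeLift_integral_comp_add hK μ w
  rw [hlift]
  refine (tphiSeminorm_integral_le r₀ zero_le_one hdom (T.rangeRestrict φ)).trans (le_of_eq ?_)
  refine integral_congr_ae (Filter.Eventually.of_forall fun ξ => ?_)
  simp only []
  rw [tphiSeminorm_comp_add_right, tayNorm_eq_tphiSeminorm, map_add]

/-- **`‖e^F‖_{T_φ} ≤ e^{‖F‖_{T_φ}}` for complex `F`** relative to any gauge ([BBS19] (7.1.4); the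
estimate behind the exponential map of [ABKM19] Lemma 8.6).
[cite: AdamsBuchholzKoteckyMuller2019, Lemma 8.6] -/
theorem tayNorm_cexp_le_exp [FiniteDimensional ℝ E] (T : E →ₗ[ℝ] V) {r₀ : ℕ} {F : E → ℂ}
    (hF : ContDiff ℝ r₀ F) (φ : E) :
    tayNorm T r₀ (fun ψ => Complex.exp (F ψ)) φ ≤ Real.exp (tayNorm T r₀ F φ) := by
  rw [tayNorm_eq_tphiSeminorm, tayNorm_eq_tphiSeminorm]
  exact tphiSeminorm_cexp_le_exp r₀ zero_le_one (contDiff_gaugeLift T hF) _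

/-- **Stability form** `‖e^{−F}‖_{T_φ} ≤ e^{−Re F(φ)} e^{‖F‖_{T_φ} − |F(φ)|}` for complex `T`-local `F`
relative to any gauge ([BBS19] Lemma 7.4.1: a large positive real part of `F(φ)` is not wasted —
the form used for `e^{−H}` with `H` a relevant Hamiltonian).
[cite: AdamsBuchholzKoteckyMuller2019, Lemma 8.6] -/
theorem tayNorm_cexp_neg_le [FiniteDimensional ℝ E] (T : E →ₗ[ℝ] V) {r₀ : ℕ} {F : E → ℂ} (hF : ContDiff ℝ r₀ F)
    (hloc : IsGaugeLocal T F) (φ : E) :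
    tayNorm T r₀ (fun ψ => Complex.exp (-F ψ)) φ ≤
      Real.exp (-(F φ).re) * Real.exp (tayNorm T r₀ F φ - ‖F φ‖) := by
  rw [tayNorm_eq_tphiSeminorm, tayNorm_eq_tphiSeminorm, ← gaugeLift_rangeRestrict hloc φ]
  exact tphiSeminorm_cexp_neg_le r₀ zero_le_one (contDiff_gaugeLift T hF) _

/-- `‖e^F‖_{T_φ} ≤ e^{‖F‖_{T_φ}}` for real `F` relative to any gauge ([BBS19] (7.1.4)).
[cite: AdamsBuchholzKoteckyMuller2019, Lemma 8.6] -/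
theorem tayNorm_exp_le_exp [FiniteDimensional ℝ E] (T : E →ₗ[ℝ] V) {r₀ : ℕ} {F : E → ℝ}
    (hF : ContDiff ℝ r₀ F) (φ : E) :
    tayNorm T r₀ (fun ψ => Real.exp (F ψ)) φ ≤ Real.exp (tayNorm T r₀ F φ) := by
  rw [tayNorm_eq_tphiSeminorm, tayNorm_eq_tphiSeminorm]
  exact tphiSeminorm_exp_le_exp r₀ zero_le_one (contDiff_gaugeLift T hF) _

end Literature.MathematicalPhysics.StatisticalMechanics.GradientRG

end
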